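import Mathlib
import HarnessLib
import Summits.NavierStokesRegularity.NavierStokesRegularity.Theses.QuarterLogPincer
import Summits.NavierStokesRegularity.NavierStokesRegularity.Theorems.QuarterLogPincerThinCascadeDefs
import Summits.NavierStokesRegularity.NavierStokesRegularity.Theorems.QuarterLogPincerTypeIQuantSubcubicExpFrameTools
import Summits.NavierStokesRegularity.NavierStokesRegularity.Theorems.QuarterLogPincerTypeIQuantSubcubicExpViolatorCascade

/-!
# Crux `QuarterLogPincer.TypeIQuantSubcubicExp` (stmt-NavierStokesRegularity-24077), line `thin_cascade`:
  registered STUB `stub_cheapCascades` — PROVED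

The registered stub S1 of the skeleton `Cruxes/TypeIQuantSubcubicExp/Lines/thin_cascade.lean` (ns-idea-7,
version of record v4 `972f24fcf0c3`, critic idea-crit-7 PASS-WITH-PRICE), proved BY NAME with its
registered signature in the line's namespace, over the re-homed definitions module
`Theorems.QuarterLogPincerThinCascadeDefs` (`TaoFrame`, `CheapCascade` verbatim):

  `¬ TypeIQuantSubcubicExp → ∃ M q, 0 < q ∧ ∀ K, CheapCascade M q K`.

Proof (the card's plan (a)+(b); (a) is `Theorems.ThinCascade.cheapCascade_of_violator`).  Let `M` be a
Type-I constant for which the crux fails and suppose, for contradiction, that for every budget `q > 0`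
some length `K(q)` admits no cheap cascade.  By (a) (contrapositive) every admissible value
`‖u(t,x)‖√t` of the crux's data with `L³` level `A` is `< exp(2K(q) + A³/q + 2)`.  The OPTIMAL RATE
`F_*(A) := sSup {admissible values at level A}` is therefore a real supremum (`q = 1` bounds the set),
obeys the bound clause of the crux by `le_csSup`, and is `≤ exp(εA³)` for `A ≥ max 2 ((4K(2/ε)+4)/ε)`
(`q = 2/ε`; `Real.sSup_le`, which also covers the empty set) — so the crux holds at `M`, contradiction.
The critic's `F_* = ⊤` branch does not arise: finiteness of the supremum is part of the argument.

HONEST FRAMING: one registered stub (size M, elementary bookkeeping) of an open crux; the line's open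
content is `stub_thinObjectExtraction` (L/XL) and the deciding `stub_thinCascadeLiouville` (the DSS wall,
width 0).  No statement about Navier–Stokes regularity and no summit statement is proved by this file.
-/

noncomputable section

-- the summit-side namespace `Summit.NavierStokesRegularity.NavierStokesRegularity.…` (single-conjunct summit,
-- D-0017) repeats a component by design; the dupNamespace linter would flag every declaration.
set_option linter.dupNamespace false

namespace Summit.NavierStokesRegularity.NavierStokesRegularity.Cruxes.TypeIQuantSubcubicExp.ThinCascade

open MeasureTheory Set
open Literature.Analysis.FluidPDE
open Summit.NavierStokesRegularity.NavierStokesRegularity.Theorems.ThinCascade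

/-- If no cheap cascade of length `K`, Type-I constant `M` and budget `q > 0` exists, every admissible
value `‖u(t,x)‖√t` of the crux's data (Tao frame on `[0,T]`, `τ > 0`, virtual Type-I bound with constant
`M`, `L³` history `≤ A`, `A ≥ 0`, `0 < t ≤ T`) is `< exp(2K + A³/q + 2)` (contrapositive of
`cheapCascade_of_violator`). [folklore] -/
theorem admissibleValue_lt_of_not_cheapCascade {M q : ℝ} {K : ℕ} (hq : 0 < q)
    (hK : ¬ CheapCascade M q K) {T τ A : ℝ}
    {u : ℝ → EuclideanSpace ℝ (Fin 3) → EuclideanSpace ℝ (Fin 3)}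
    {p : ℝ → EuclideanSpace ℝ (Fin 3) → ℝ} (hframe : TaoFrame T u p) (hτ : 0 < τ)
    (htypeI : ∀ t ∈ Icc 0 T, ∀ x : EuclideanSpace ℝ (Fin 3),
      ‖u t x‖ ≤ M * (T + τ - t) ^ (-(1 / 2 : ℝ)))
    (hL3 : ∀ t ∈ Icc 0 T, eLpNorm (u t) 3 volume ≤ ENNReal.ofReal A) (hA : 0 ≤ A)
    {t : ℝ} (ht : t ∈ Ioc 0 T) (x : EuclideanSpace ℝ (Fin 3)) :
    ‖u t x‖ * Real.sqrt t < Real.exp (2 * K + A ^ 3 / q + 2) := by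
  by_contra hle
  exact hK (cheapCascade_of_violator hframe hτ htypeI hL3 hA hq ht (not_lt.1 hle))

/-- **Registered stub `stub_cheapCascades` (PROVED; signature verbatim).**  If the subcubic-exponential
Type-I rate fails then, for the offending Type-I constant `M` and some budget `q > 0`, cheap cascades of
every length exist.  Proof: the optimal rate `F_*(A) = sSup` of the admissible values closes the crux at
`M` as soon as every budget has a forbidden length (`admissibleValue_lt_of_not_cheapCascade` with `q = 1`
for finiteness and `q = 2/ε` for the `exp(εA³)` bound). [folklore] -/
theorem stub_cheapCascades :
    ¬ Summit.NavierStokesRegularity.NavierStokesRegularity.Theses.QuarterLogPincer.TypeIQuantSubcubicExp →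
      ∃ M q : ℝ, 0 < q ∧ ∀ K : ℕ, CheapCascade M q K := by
  intro hneg
  by_contra hno
  apply hneg
  intro M
  -- every budget has a forbidden length
  have hK : ∀ q : ℝ, 0 < q → ∃ K : ℕ, ¬ CheapCascade M q K := by
    intro q hq
    by_contra h
    push Not at h
    exact hno ⟨M, q, hq, h⟩
  -- the admissible values at `L³` level `A`
  obtain ⟨S, hS⟩ : ∃ S : ℝ → Set ℝ, S = fun A => {r : ℝ | ∃ (T τ : ℝ)
      (u : ℝ → EuclideanSpace ℝ (Fin 3) → EuclideanSpace ℝ (Fin 3))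
      (p : ℝ → EuclideanSpace ℝ (Fin 3) → ℝ) (t : ℝ) (x : EuclideanSpace ℝ (Fin 3)),
      TaoFrame T u p ∧ 0 < τ ∧
      (∀ t ∈ Icc 0 T, ∀ x : EuclideanSpace ℝ (Fin 3), ‖u t x‖ ≤ M * (T + τ - t) ^ (-(1 / 2 : ℝ))) ∧
      (∀ t ∈ Icc 0 T, eLpNorm (u t) 3 volume ≤ ENNReal.ofReal A) ∧ 2 ≤ A ∧
      t ∈ Ioc 0 T ∧ r = ‖u t x‖ * Real.sqrt t} := ⟨_, rfl⟩
  -- every admissible value is below `exp(2K(q) + A³/q + 2)`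
  have hlt : ∀ q : ℝ, 0 < q → ∃ K : ℕ, ∀ A : ℝ, ∀ r ∈ S A,
      r < Real.exp (2 * K + A ^ 3 / q + 2) := by
    intro q hq
    obtain ⟨K, hKq⟩ := hK q hq
    refine ⟨K, fun A r hr => ?_⟩
    rw [hS] at hr
    obtain ⟨T, τ, u, p, t, x, hframe, hτ, htypeI, hL3, hA, ht, rfl⟩ := hr
    exact admissibleValue_lt_of_not_cheapCascade hq hKq hframe hτ htypeI hL3 (by linarith) ht x
  -- finiteness (`q = 1`)
  have hbdd : ∀ A : ℝ, BddAbove (S A) := by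
    obtain ⟨K, hK1⟩ := hlt 1 one_pos
    exact fun A => ⟨Real.exp (2 * K + A ^ 3 / 1 + 2), fun r hr => (hK1 A r hr).le⟩
  refine ⟨fun A => sSup (S A), ?_, ?_⟩
  · -- growth `o(A³)`: budget `q = 2/ε`
    intro ε hε
    obtain ⟨K, hKε⟩ := hlt (2 / ε) (by positivity)
    refine ⟨max 2 ((4 * K + 4) / ε), fun A hA => ?_⟩
    have hA2 : 2 ≤ A := le_trans (le_max_left _ _) hA
    have hAK : (4 * K + 4) / ε ≤ A := le_trans (le_max_right _ _) hA
    have hAK' : 4 * (K : ℝ) + 4 ≤ ε * A := by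
      rw [div_le_iff₀ hε] at hAK
      linarith [mul_comm A ε]
    have hA3 : A ≤ A ^ 3 := by
      have h1 : (1 : ℝ) ≤ A ^ 2 := by nlinarith
      calc A = A * 1 := by ring
        _ ≤ A * A ^ 2 := mul_le_mul_of_nonneg_left h1 (by linarith)
        _ = A ^ 3 := by ring
    have hεA : ε * A ≤ ε * A ^ 3 := mul_le_mul_of_nonneg_left hA3 hε.le
    refine Real.sSup_le (fun r hr => (hKε A r hr).le.trans (Real.exp_le_exp.2 ?_)) (Real.exp_pos _).le
    have e : A ^ 3 / (2 / ε) = ε * A ^ 3 / 2 := by field_simp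
    rw [e]
    linarith
  · -- the bound clause, by `le_csSup`
    intro T τ A u p hframe hτ htypeI hL3 hA t ht x
    have hmem : ‖u t x‖ * Real.sqrt t ∈ S A := by
      rw [hS]
      exact ⟨T, τ, u, p, t, x, hframe, hτ, htypeI, hL3, hA, ht, rfl⟩
    exact le_mul_rpow_neg_half_of_mul_sqrt_le ht.1 (le_csSup (hbdd A) hmem)

end Summit.NavierStokesRegularity.NavierStokesRegularity.Cruxes.TypeIQuantSubcubicExp.ThinCascade

end
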